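import Summits.AtomisticToContinuum.FouriersLaw.Theorems.BondHeatUncertaintySubdiffusiveBondHeatKernelGibbsF
import Mathlib.MeasureTheory.Integral.IntervalIntegral.Basic

/-!
# Equilibrium autocorrelations of the pinned chain: generic observables of exponential class

Support file for item `stmt-AtomisticToContinuum-9123` (`BondHeatUncertainty.LightConeBondHeat`, the light-cone
window law `V_N(b,t) ≤ A√t`, `1 ≤ t ≤ aN`, for the equilibrium bond-heat variance
`V_N(b,t) = 2∫₀ᵗ (t−s) C_N(b,s) ds`, `C_N(b,s) = ∫ j_b · P_s j_b dμ_T`).  Before any window law can be attacked the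
objects must be honest for a BULK bond `b` (the crux line `bath-bond-deficit-integral` of stmt-9120 works at the bath
bond `b = 0` with the kinetic observable `p₀² − T` only).  This file proves, for the pinned anharmonic chain
`pinnedChain ω₂ lam β γ` (`ω₂ > 0`, `lam ≥ 0`, `β, γ > 0`, `N ≥ 1`, `T > 0`) and ANY continuous observable `f` of
exponential class `|f| ≤ C e^{ϑH}` with `0 < ϑ`, `2ϑ < 1/T`, the basic properties of the equilibrium
autocorrelation `K_f(u) = ∫ f · P_{u⁺} f dμ_T` (constructed kernels `transitionKernel N T T`, Gibbs measure
`gibbsMeasure N T`):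

* `pinnedChain_autocorr_abs_le` — `|K_f(u)| ≤ ∫ f² dμ_T` (Jensen for the Markov kernel + kernel Gibbs invariance);
* `pinnedChain_measurable_autocorr` — `u ↦ K_f(u)` is measurable (joint measurability of the kernels);
* `pinnedChain_continuous_autocorr` — `u ↦ K_f(u)` is continuous (uniform limit of the autocorrelations of the
  bounded truncations of `f`, via the `L²(μ_T)`-contraction);
* `pinnedChain_autocorr_exp_decay` — if `∫ f dμ_T = 0` then `|K_f(u)| ≤ C' e^{−cu}` (`c > 0`; CEHR (2.5) with the
  limit identified, at FIXED `N` — the rate is not uniform in `N`);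
* `pinnedChain_intervalIntegrable_autocorr`, `pinnedChain_abs_heatVar_le_sq` — the variance functional
  `2∫₀ᵗ (t−s) K_f(s) ds` is a genuine integral and is bounded by `2 (∫ f² dμ_T) t²` for `t ≥ 0`.

The bond currents `j_b` are of exponential class for every `ϑ > 0`, so all of this applies to `C_N(b,·)` and
`V_N(b,·)` at every bond (file `BondHeatUncertaintyLightConeBondHeatBondCorrelation`).  The proofs generalise
parts E/F of `BondHeatUncertaintySubdiffusiveBondHeatKernelGibbs` from `p₀² − T` to `f`.
-/

noncomputable section

open MeasureTheory ProbabilityTheory Filter Topology Set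
open scoped NNReal ENNReal

namespace Summit.AtomisticToContinuum.FouriersLaw.Theorems.LightConeBondHeat

open Literature.MathematicalPhysics.KineticTheory.HeatConduction
open Literature.MathematicalPhysics.KineticTheory Literature.Probability.Process OscillatorChain
open Summit.AtomisticToContinuum.FouriersLaw.Theorems.SubdiffusiveBondHeat

variable {N : ℕ}

section Generic

variable {ω₂ lam β γ : ℝ} (hω : 0 < ω₂) (hl : 0 ≤ lam) (hβ : 0 < β) (hγ : 0 < γ) {N : ℕ} (hN : 0 < N)
  {T : ℝ} (hT : 0 < T) {ϑ C : ℝ} (hϑ0 : 0 < ϑ) (h2ϑ : 2 * ϑ < 1 / T) {f : PhaseSpace N → ℝ}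
  (hf : Continuous f) (hfb : ∀ y, |f y| ≤ C * Real.exp (ϑ * (pinnedChain ω₂ lam β γ).hamiltonian N y))
include hω hl hβ hγ hN hT hϑ0 h2ϑ hf hfb

/-- **`|K_f(u)| ≤ ∫ f² dμ_T`**: the equilibrium autocorrelation of a continuous observable of exponential class is
bounded by its static second moment (`|f g| ≤ (f² + g²)/2` with `g = P_u f`, Jensen `g² ≤ P_u(f²)` for the Markov
kernel, and invariance `∫ P_u(f²) dμ_T = ∫ f² dμ_T`). [folklore] -/
theorem pinnedChain_autocorr_abs_le (u : ℝ≥0) :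
    |∫ z, f z * (∫ y, f y ∂((pinnedChain ω₂ lam β γ).transitionKernel N T T u z))
      ∂((pinnedChain ω₂ lam β γ).gibbsMeasure N T)| ≤
      ∫ z, f z ^ 2 ∂((pinnedChain ω₂ lam β γ).gibbsMeasure N T) := by
  set P := pinnedChain ω₂ lam β γ with hP
  set μ := P.gibbsMeasure N T with hμ
  set κ := P.transitionKernel N T T u with hκ
  obtain ⟨hf2μ, hg2int, hg2le⟩ := pinnedChain_integral_sq_act_le hω hl hβ hγ hN hT hϑ0 h2ϑ hf hfb u
  set g : PhaseSpace N → ℝ := fun z => ∫ y, f y ∂(κ z) with hg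
  have hbound : ∀ z, ‖f z * g z‖ ≤ (f z ^ 2 + g z ^ 2) / 2 := fun z => by
    rw [Real.norm_eq_abs, abs_mul]
    nlinarith [sq_nonneg (|f z| - |g z|), sq_abs (f z), sq_abs (g z), abs_nonneg (f z), abs_nonneg (g z)]
  have hbint : Integrable (fun z => (f z ^ 2 + g z ^ 2) / 2) μ := (hf2μ.add hg2int).div_const 2
  have := norm_integral_le_of_norm_le hbint (Eventually.of_forall hbound)
  rw [Real.norm_eq_abs, integral_div, integral_add hf2μ hg2int] at this
  linarith

omit hβ hγ hN hϑ0 h2ϑ hfb in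
/-- `u ↦ K_f(u)` is a measurable function of time (joint measurability of the transition kernels in `(t, z)`).
[folklore] -/
theorem pinnedChain_measurable_autocorr (hβ : 0 ≤ β) (hγ : 0 ≤ γ) :
    Measurable fun u : ℝ => ∫ z, f z *
        (∫ y, f y ∂((pinnedChain ω₂ lam β γ).transitionKernel N T T u.toNNReal z))
      ∂((pinnedChain ω₂ lam β γ).gibbsMeasure N T) := by
  set P := pinnedChain ω₂ lam β γ with hP
  set μ := P.gibbsMeasure N T with hμ
  haveI : IsProbabilityMeasure μ := pinnedChain_isProbabilityMeasure_gibbsMeasure hω hl hβ γ N hT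
  -- the kernels as ONE kernel on `ℝ≥0 × Ω`
  let κ₂ : Kernel (ℝ≥0 × PhaseSpace N) (PhaseSpace N) :=
    { toFun := fun p => P.transitionKernel N T T p.1 p.2
      measurable' := pinnedChain_measurable_transitionKernel hω hl hβ hγ N T T }
  have hG : StronglyMeasurable fun p : ℝ≥0 × PhaseSpace N => ∫ y, f y ∂(κ₂ p) :=
    hf.stronglyMeasurable.integral_kernel (κ := κ₂)
  have hF : StronglyMeasurable fun q : ℝ × PhaseSpace N =>
      f q.2 * ∫ y, f y ∂(P.transitionKernel N T T q.1.toNNReal q.2) := by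
    have h1 : StronglyMeasurable fun q : ℝ × PhaseSpace N => f q.2 :=
      (hf.comp continuous_snd).stronglyMeasurable
    have h2 : StronglyMeasurable fun q : ℝ × PhaseSpace N => ∫ y, f y ∂(κ₂ (q.1.toNNReal, q.2)) :=
      hG.comp_measurable ((measurable_real_toNNReal.comp measurable_fst).prodMk measurable_snd)
    exact h1.mul h2
  exact (hF.integral_prod_right' (ν := μ)).measurable

/-- **Exponential decay of `K_f` at fixed `N`**: if `∫ f dμ_T = 0` then `|K_f(u)| ≤ C' e^{−cu}` for all `u ≥ 0`
with `c > 0` — exponential convergence of `P_u f(z)` to `μ_T(f) = 0` with weight `e^{ϑH(z)}` (CEHR (2.5), limit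
identified by Harris uniqueness), integrated against `|f| e^{ϑH} ≤ C e^{2ϑH} ∈ L¹(μ_T)`.  The rate `c` depends on
`N`. [cite: CuneoEckmannHairerReyBellet2018, Thm 2.13 (3)] -/
theorem pinnedChain_autocorr_exp_decay
    (h0 : ∫ z, f z ∂((pinnedChain ω₂ lam β γ).gibbsMeasure N T) = 0) :
    ∃ C' c : ℝ, 0 < c ∧ ∀ u : ℝ, 0 ≤ u →
      |∫ z, f z * (∫ y, f y ∂((pinnedChain ω₂ lam β γ).transitionKernel N T T u.toNNReal z))
        ∂((pinnedChain ω₂ lam β γ).gibbsMeasure N T)| ≤ C' * Real.exp (-c * u) := by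
  set P := pinnedChain ω₂ lam β γ with hP
  set μ := P.gibbsMeasure N T with hμ
  have hϑ1 : ϑ < 1 / T := by linarith
  obtain ⟨C₀, c, hC₀, hc, hconv⟩ := pinnedChain_exp_convergence_gibbs hω hl hβ hγ hN hT hϑ0 hϑ1
  set M : ℝ := |C| + 1 with hM
  have hM0 : 0 < M := by positivity
  have hfM : ∀ y, |f y| ≤ M * Real.exp (ϑ * P.hamiltonian N y) := fun y =>
    (hfb y).trans (mul_le_mul_of_nonneg_right (by rw [hM]; linarith [le_abs_self C]) (Real.exp_pos _).le)
  -- the weight `|f| e^{ϑH} ≤ M e^{2ϑH}` is `μ_T`-integrable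
  have hwint : Integrable (fun z => |f z| * Real.exp (ϑ * P.hamiltonian N z)) μ := by
    have h2 := pinnedChain_integrable_exp_mul_hamiltonian_gibbsMeasure hω hl hβ.le γ N hT h2ϑ
    refine (h2.const_mul M).mono' ((continuous_abs.comp hf).mul (Real.continuous_exp.comp
      (continuous_const.mul (pinnedChain_continuous_hamiltonian ω₂ lam β γ N)))).aestronglyMeasurable
      (Eventually.of_forall fun z => ?_)
    rw [Real.norm_eq_abs, abs_mul, abs_abs, abs_of_pos (Real.exp_pos _)]
    calc |f z| * Real.exp (ϑ * P.hamiltonian N z) ≤ (M * Real.exp (ϑ * P.hamiltonian N z)) *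
        Real.exp (ϑ * P.hamiltonian N z) := mul_le_mul_of_nonneg_right (hfM z) (Real.exp_pos _).le
      _ = M * Real.exp (2 * ϑ * P.hamiltonian N z) := by rw [mul_assoc, ← Real.exp_add]; ring_nf
  set W : ℝ := ∫ z, |f z| * Real.exp (ϑ * P.hamiltonian N z) ∂μ with hW
  refine ⟨M * C₀ * W, c, hc, fun u hu => ?_⟩
  -- pointwise decay of `P_u f`
  have hpt : ∀ z, |∫ y, f y ∂(P.transitionKernel N T T u.toNNReal z)| ≤
      M * C₀ * Real.exp (ϑ * P.hamiltonian N z) * Real.exp (-c * u) := by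
    intro z
    have hf' : Continuous fun y => M⁻¹ * f y := continuous_const.mul hf
    have hfb' : ∀ y, |M⁻¹ * f y| ≤ Real.exp (ϑ * P.hamiltonian N y) := fun y => by
      rw [abs_mul, abs_of_pos (inv_pos.2 hM0), inv_mul_le_iff₀ hM0]
      exact hfM y
    have h := hconv z u.toNNReal _ hf' hfb'
    rw [integral_const_mul, integral_const_mul, h0, mul_zero, sub_zero, abs_mul,
      abs_of_pos (inv_pos.2 hM0), inv_mul_le_iff₀ hM0, Real.coe_toNNReal _ hu] at h
    calc |∫ y, f y ∂(P.transitionKernel N T T u.toNNReal z)|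
        ≤ M * (C₀ * Real.exp (ϑ * P.hamiltonian N z) * Real.exp (-c * u)) := h
      _ = M * C₀ * Real.exp (ϑ * P.hamiltonian N z) * Real.exp (-c * u) := by ring
  -- integrate
  have hbound : ∀ z, ‖f z * ∫ y, f y ∂(P.transitionKernel N T T u.toNNReal z)‖ ≤
      M * C₀ * Real.exp (-c * u) * (|f z| * Real.exp (ϑ * P.hamiltonian N z)) := fun z => by
    rw [Real.norm_eq_abs, abs_mul]
    calc |f z| * |∫ y, f y ∂(P.transitionKernel N T T u.toNNReal z)|
        ≤ |f z| * (M * C₀ * Real.exp (ϑ * P.hamiltonian N z) * Real.exp (-c * u)) :=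
          mul_le_mul_of_nonneg_left (hpt z) (abs_nonneg _)
      _ = M * C₀ * Real.exp (-c * u) * (|f z| * Real.exp (ϑ * P.hamiltonian N z)) := by ring
  have := norm_integral_le_of_norm_le (hwint.const_mul (M * C₀ * Real.exp (-c * u))) (Eventually.of_forall hbound)
  rw [integral_const_mul, Real.norm_eq_abs] at this
  calc _ ≤ M * C₀ * Real.exp (-c * u) * W := this
    _ = M * C₀ * W * Real.exp (-c * u) := by ring

/-- **Continuity of `u ↦ K_f(u)`**: `K_f` is the uniform limit of the (continuous) autocorrelations of the bounded
truncations `f^M = max(-M, min(M, f))`, the error being controlled by the `L²(μ_T)`-contraction of `P_u` and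
`∫ (f - f^M)² dμ_T → 0`. [folklore] -/
theorem pinnedChain_continuous_autocorr :
    Continuous fun u : ℝ => ∫ z, f z *
        (∫ y, f y ∂((pinnedChain ω₂ lam β γ).transitionKernel N T T u.toNNReal z))
      ∂((pinnedChain ω₂ lam β γ).gibbsMeasure N T) := by
  set P := pinnedChain ω₂ lam β γ with hP
  set μ := P.gibbsMeasure N T with hμ
  set κ : ℝ → Kernel (PhaseSpace N) (PhaseSpace N) := fun u => P.transitionKernel N T T u.toNNReal with hκ
  haveI : IsProbabilityMeasure μ := pinnedChain_isProbabilityMeasure_gibbsMeasure hω hl hβ.le γ N hT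
  -- a nonnegative domination constant
  set M₀ : ℝ := |C| + 1 with hM₀
  have hfM : ∀ y, |f y| ≤ M₀ * Real.exp (ϑ * P.hamiltonian N y) := fun y =>
    (hfb y).trans (mul_le_mul_of_nonneg_right (by rw [hM₀]; linarith [le_abs_self C]) (Real.exp_pos _).le)
  -- truncations
  set fM : ℕ → PhaseSpace N → ℝ := fun M z => max (-(M:ℝ)) (min (M:ℝ) (f z)) with hfM'
  have hfMc : ∀ M, Continuous (fM M) := fun M => continuous_const.max (continuous_const.min hf)
  have hfMb : ∀ M y, ‖fM M y‖ ≤ M := fun M y => by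
    rw [Real.norm_eq_abs, abs_le]
    refine ⟨le_max_left _ _, max_le (by linarith [(M.cast_nonneg : (0:ℝ) ≤ M)]) (min_le_left _ _)⟩
  have hfMle : ∀ M y, |fM M y| ≤ |f y| := fun M y => by
    simp only [hfM']
    rcases le_total 0 (f y) with h | h
    · rw [abs_of_nonneg h, abs_of_nonneg (le_max_of_le_right (le_min (M.cast_nonneg) h))]
      exact max_le (by linarith [(M.cast_nonneg : (0:ℝ) ≤ M)]) (min_le_right _ _)
    · have : min (M:ℝ) (f y) = f y := min_eq_right (h.trans M.cast_nonneg)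
      rw [this, abs_of_nonpos h]
      rcases le_total (-(M:ℝ)) (f y) with h' | h'
      · rw [max_eq_right h', abs_of_nonpos h]
      · rw [max_eq_left h', abs_neg, abs_of_nonneg (M.cast_nonneg)]; linarith
  have hdiffle : ∀ M y, |f y - fM M y| ≤ |f y| := fun M y => by
    simp only [hfM']
    rcases le_total 0 (f y) with h | h
    · have hmax : max (-(M:ℝ)) (min (M:ℝ) (f y)) = min (M:ℝ) (f y) :=
        max_eq_right (le_min (by linarith [(M.cast_nonneg : (0:ℝ) ≤ M)]) (by linarith [(M.cast_nonneg : (0:ℝ) ≤ M)]))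
      rw [hmax, abs_of_nonneg h]
      rcases le_total (M:ℝ) (f y) with h' | h'
      · rw [min_eq_left h', abs_of_nonneg (by linarith)]; linarith [(M.cast_nonneg : (0:ℝ) ≤ M)]
      · rw [min_eq_right h', sub_self, abs_zero]; exact h
    · have : min (M:ℝ) (f y) = f y := min_eq_right (h.trans M.cast_nonneg)
      rw [this, abs_of_nonpos h]
      rcases le_total (-(M:ℝ)) (f y) with h' | h'
      · rw [max_eq_right h', sub_self, abs_zero]; linarith
      · rw [max_eq_left h', abs_of_nonpos (by linarith)]; linarith [(M.cast_nonneg : (0:ℝ) ≤ M)]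
  have hfMexp : ∀ M y, |fM M y| ≤ M₀ * Real.exp (ϑ * P.hamiltonian N y) := fun M y => (hfMle M y).trans (hfM y)
  have hdexp : ∀ M y, |f y - fM M y| ≤ M₀ * Real.exp (ϑ * P.hamiltonian N y) := fun M y =>
    (hdiffle M y).trans (hfM y)
  -- L² facts
  have hA := pinnedChain_integral_sq_act_le hω hl hβ hγ hN hT hϑ0 h2ϑ hf hfM
  set A : ℝ := ∫ z, f z ^ 2 ∂μ with hAdef
  have hA0 : 0 ≤ A := integral_nonneg fun z => sq_nonneg _
  set δ : ℕ → ℝ := fun M => ∫ z, (f z - fM M z) ^ 2 ∂μ with hδ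
  have hδlim : Tendsto δ atTop (𝓝 0) := by
    have h0 : (0:ℝ) = ∫ z, (0:ℝ) ∂μ := by simp
    rw [h0]
    refine tendsto_integral_of_dominated_convergence (fun z => f z ^ 2)
      (fun M => (((hf.sub (hfMc M)).pow 2)).aestronglyMeasurable) (hA 0).1
      (fun M => Eventually.of_forall fun z => ?_) (Eventually.of_forall fun z => ?_)
    · rw [Real.norm_eq_abs, abs_pow, ← sq_abs (f z)]
      exact pow_le_pow_left₀ (abs_nonneg _) (hdiffle M z) 2
    · refine tendsto_const_nhds.congr' ?_
      obtain ⟨M₁, hM₁⟩ := exists_nat_ge |f z|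
      filter_upwards [eventually_ge_atTop M₁] with M hM
      have hMr : |f z| ≤ M := hM₁.trans (by exact_mod_cast hM)
      have : fM M z = f z := by
        simp only [hfM']
        rw [min_eq_right (abs_le.1 hMr).2, max_eq_right (abs_le.1 hMr).1]
      simp [this]
  -- the continuous approximants
  set K : ℝ → ℝ := fun u => ∫ z, f z * (∫ y, f y ∂(κ u z)) ∂μ with hK
  set KM : ℕ → ℝ → ℝ := fun M u => ∫ z, fM M z * (∫ y, fM M y ∂(κ u z)) ∂μ with hKM
  have hKMc : ∀ M, Continuous (KM M) := fun M =>
    pinnedChain_continuous_corr_bounded hω hl hβ hγ hT (hfMc M) (hfMb M)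
  -- uniform approximation
  have hunif : TendstoUniformly KM K atTop := by
    rw [Metric.tendstoUniformly_iff]
    intro η hη
    set ε : ℝ := η / (2 * A + 2) with hε
    have hε0 : 0 < ε := by positivity
    have hδev : ∀ᶠ M in atTop, δ M < ε * (η / 2) :=
      (tendsto_order.1 hδlim).2 _ (by positivity)
    filter_upwards [hδev] with M hM u
    rw [Real.dist_eq]
    set uu : ℝ≥0 := u.toNNReal
    have hB1 := pinnedChain_integral_sq_act_le hω hl hβ hγ hN hT hϑ0 h2ϑ hf hfM uu
    have hB2 := pinnedChain_integral_sq_act_le hω hl hβ hγ hN hT hϑ0 h2ϑ (f := fun y => f y - fM M y)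
      (hf.sub (hfMc M)) (hdexp M) uu
    have hB3 := pinnedChain_integral_sq_act_le hω hl hβ hγ hN hT hϑ0 h2ϑ (hfMc M) (hfMexp M) uu
    haveI : IsMarkovKernel (κ u) := pinnedChain_isMarkovKernel_transitionKernel hω hl hβ.le hγ.le N T T uu
    have hϑ1 : ϑ < 1 / T := by linarith
    have hθκ : ∀ z, Integrable f (κ u z) := fun z => integrable_of_abs_le_exp
      (pinnedChain_integrable_exp_mul_hamiltonian_transitionKernel hω hl hT hβ.le hγ.le hN hϑ0 hϑ1 uu z) hf hfM
    have hθMκ : ∀ z, Integrable (fM M) (κ u z) := fun z => integrable_of_abs_le_exp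
      (pinnedChain_integrable_exp_mul_hamiltonian_transitionKernel hω hl hT hβ.le hγ.le hN hϑ0 hϑ1 uu z)
      (hfMc M) (hfMexp M)
    have hsplit : ∀ z, f z * (∫ y, f y ∂(κ u z)) - fM M z * (∫ y, fM M y ∂(κ u z)) =
        (f z - fM M z) * (∫ y, f y ∂(κ u z)) + fM M z * (∫ y, (f y - fM M y) ∂(κ u z)) := by
      intro z
      rw [integral_sub (hθκ z) (hθMκ z)]
      ring
    -- integrability of the two products (AM–GM domination)
    have hprod_int : ∀ {a b : PhaseSpace N → ℝ}, AEStronglyMeasurable a μ → AEStronglyMeasurable b μ →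
        Integrable (fun z => a z ^ 2) μ → Integrable (fun z => b z ^ 2) μ → Integrable (fun z => a z * b z) μ := by
      intro a b ham hbm ha hb
      have hI : Integrable (fun z => (a z ^ 2 + b z ^ 2) / 2) μ := (ha.add hb).div_const 2
      refine hI.mono' (ham.mul hbm) (Eventually.of_forall fun z => ?_)
      show ‖a z * b z‖ ≤ (a z ^ 2 + b z ^ 2) / 2
      rw [Real.norm_eq_abs, abs_mul]
      nlinarith [sq_nonneg (|a z| - |b z|), sq_abs (a z), sq_abs (b z)]
    have hm1 : AEStronglyMeasurable (fun z => ∫ y, f y ∂(κ u z)) μ :=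
      (hf.stronglyMeasurable.integral_kernel (κ := κ u)).aestronglyMeasurable
    have hm2 : AEStronglyMeasurable (fun z => ∫ y, (f y - fM M y) ∂(κ u z)) μ :=
      ((hf.sub (hfMc M)).stronglyMeasurable.integral_kernel (κ := κ u)).aestronglyMeasurable
    have hI1 : Integrable (fun z => (f z - fM M z) * ∫ y, f y ∂(κ u z)) μ :=
      hprod_int (a := fun z => f z - fM M z) (hf.sub (hfMc M)).aestronglyMeasurable hm1 hB2.1 hB1.2.1
    have hI2 : Integrable (fun z => fM M z * ∫ y, (f y - fM M y) ∂(κ u z)) μ :=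
      hprod_int (hfMc M).aestronglyMeasurable hm2 hB3.1 hB2.2.1
    have hI0 : Integrable (fun z => f z * ∫ y, f y ∂(κ u z)) μ :=
      hprod_int hf.aestronglyMeasurable hm1 hB1.1 hB1.2.1
    have hIM : Integrable (fun z => fM M z * ∫ y, fM M y ∂(κ u z)) μ :=
      hprod_int (hfMc M).aestronglyMeasurable
        ((hfMc M).stronglyMeasurable.integral_kernel (κ := κ u)).aestronglyMeasurable hB3.1 hB3.2.1
    have hdiff : K u - KM M u = (∫ z, (f z - fM M z) * ∫ y, f y ∂(κ u z) ∂μ) +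
        ∫ z, fM M z * ∫ y, (f y - fM M y) ∂(κ u z) ∂μ := by
      simp only [hK, hKM]
      rw [← integral_sub hI0 hIM, ← integral_add hI1 hI2]
      exact integral_congr_ae (Eventually.of_forall hsplit)
    -- the two weighted AM–GM bounds
    have hT1 := abs_integral_mul_le_weighted hB2.1 hB1.2.1 (ε := ε⁻¹) (inv_pos.2 hε0)
    have hT2 := abs_integral_mul_le_weighted hB3.1 hB2.2.1 hε0
    rw [inv_inv] at hT1
    have hPθ : ∫ z, (∫ y, f y ∂(κ u z)) ^ 2 ∂μ ≤ A := hB1.2.2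
    have hPd : ∫ z, (∫ y, (f y - fM M y) ∂(κ u z)) ^ 2 ∂μ ≤ δ M := hB2.2.2
    have hθM2le : ∫ z, fM M z ^ 2 ∂μ ≤ A :=
      integral_mono_of_nonneg (Eventually.of_forall fun z => sq_nonneg _) (hA 0).1
        (Eventually.of_forall fun z => by
          have := hfMle M z
          show fM M z ^ 2 ≤ f z ^ 2
          rw [← sq_abs (fM M z), ← sq_abs (f z)]
          exact pow_le_pow_left₀ (abs_nonneg _) this 2)
    have hδ0 : 0 ≤ δ M := integral_nonneg fun z => sq_nonneg _
    rw [hdiff]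
    calc |(∫ z, (f z - fM M z) * ∫ y, f y ∂(κ u z) ∂μ) + ∫ z, fM M z * ∫ y, (f y - fM M y) ∂(κ u z) ∂μ|
        ≤ |∫ z, (f z - fM M z) * ∫ y, f y ∂(κ u z) ∂μ| + |∫ z, fM M z * ∫ y, (f y - fM M y) ∂(κ u z) ∂μ| :=
          abs_add_le _ _
      _ ≤ (ε⁻¹ * δ M + ε * A) / 2 + (ε * A + ε⁻¹ * δ M) / 2 := by
          refine add_le_add (hT1.trans ?_) (hT2.trans ?_)
          · gcongr
          · gcongr
      _ = ε * A + ε⁻¹ * δ M := by ring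
      _ < ε * A + ε⁻¹ * (ε * (η / 2)) := by gcongr
      _ = ε * A + η / 2 := by rw [← mul_assoc, inv_mul_cancel₀ hε0.ne', one_mul]
      _ ≤ η := by
          rw [hε]
          have : η / (2 * A + 2) * A ≤ η / 2 := by
            rw [div_mul_eq_mul_div, div_le_div_iff₀ (by positivity) (by positivity)]
            nlinarith
          linarith
  exact hunif.continuous (Frequently.of_forall hKMc)

/-- The integrand `s ↦ (t − s) K_f(s)` of the variance functional is interval-integrable on every interval
(`K_f` is continuous), so `2∫₀ᵗ (t−s) K_f(s) ds` is a genuine integral. [folklore] -/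
theorem pinnedChain_intervalIntegrable_heatVar_integrand (t a b : ℝ) :
    IntervalIntegrable (fun s : ℝ => (t - s) * ∫ z, f z *
        (∫ y, f y ∂((pinnedChain ω₂ lam β γ).transitionKernel N T T s.toNNReal z))
      ∂((pinnedChain ω₂ lam β γ).gibbsMeasure N T)) volume a b :=
  ((continuous_const.sub continuous_id).mul
    (pinnedChain_continuous_autocorr hω hl hβ hγ hN hT hϑ0 h2ϑ hf hfb)).intervalIntegrable a b

/-- **The variance functional is at most quadratic**: `|2∫₀ᵗ (t−s) K_f(s) ds| ≤ 2 (∫ f² dμ_T) t²` for `t ≥ 0`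
(`|t − s| ≤ t` and `|K_f(s)| ≤ ∫ f² dμ_T` on `(0, t]`).  This is the short-time (`t = O(1)`) end of any window law
`≤ A√t`; the `√t` behaviour for large `t` is dynamical cancellation in `K_f`, not a size bound. [folklore] -/
theorem pinnedChain_abs_heatVar_le_sq {t : ℝ} (ht : 0 ≤ t) :
    |2 * ∫ s in (0:ℝ)..t, (t - s) * ∫ z, f z *
        (∫ y, f y ∂((pinnedChain ω₂ lam β γ).transitionKernel N T T s.toNNReal z))
      ∂((pinnedChain ω₂ lam β γ).gibbsMeasure N T)| ≤
      2 * (∫ z, f z ^ 2 ∂((pinnedChain ω₂ lam β γ).gibbsMeasure N T)) * t ^ 2 := by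
  set P := pinnedChain ω₂ lam β γ with hP
  set μ := P.gibbsMeasure N T with hμ
  set A : ℝ := ∫ z, f z ^ 2 ∂μ with hAdef
  set K : ℝ → ℝ := fun s => ∫ z, f z * (∫ y, f y ∂(P.transitionKernel N T T s.toNNReal z)) ∂μ with hK
  have hA0 : 0 ≤ A := integral_nonneg fun z => sq_nonneg _
  have hKle : ∀ s, |K s| ≤ A := fun s => pinnedChain_autocorr_abs_le hω hl hβ hγ hN hT hϑ0 h2ϑ hf hfb s.toNNReal
  have hbound : ∀ s ∈ uIoc (0:ℝ) t, ‖(t - s) * K s‖ ≤ t * A := by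
    intro s hs
    rw [uIoc_of_le ht] at hs
    rw [Real.norm_eq_abs, abs_mul]
    have h1 : |t - s| ≤ t := by rw [abs_le]; constructor <;> linarith [hs.1, hs.2]
    exact mul_le_mul h1 (hKle s) (abs_nonneg _) ht
  have h := intervalIntegral.norm_integral_le_of_norm_le_const hbound
  rw [Real.norm_eq_abs, sub_zero, abs_of_nonneg ht] at h
  rw [abs_mul, abs_two]
  nlinarith [h]

end Generic

end Summit.AtomisticToContinuum.FouriersLaw.Theorems.LightConeBondHeat

end
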